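import Mathlib
import Literature.NumberTheory.DiophantineGeometry.SymmetricGroupReps
import HarnessLib

/-!
# Ellis–Friedgut–Pilpel: the span of the `k`-cosets of `𝔖ₙ` (statement only)

Topic `Literature/RepresentationTheory/FiniteGroups` (family `MatrixMultiplication`). Requested by
route `MatrixMultiplication/LevelGradedCohnUmans`: its support items `TokenBudget`, `TokenWall`,
`KillLinkLevelTwo` and the crux `SnLevelDesigns` inline the "`k`-token test space"
`J_k = {g ↦ ∑_{p : [k] → [n]} c_p(g ∘ p)}` of functions on `𝔖ₙ`, which is the span `V_k` of the
characteristic functions of the `k`-cosets, and price it through the partitions `μ` with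
`μ₁ ≥ n - k`; the identification of the irreducibles occurring in `V_k` is exactly the theorem
below (grounds `Summit.MatrixMultiplication.MatrixMultiplication.Theses.LevelGradedCohnUmans.TokenBudget`
and `.TokenWall`).

## The printed statements (D. Ellis, E. Friedgut, H. Pilpel, *Intersecting families of
permutations*, J. Amer. Math. Soc. 24 (2011) 649–682 = arXiv:1011.3342; held text pp. 3, 5, 6, 13–14)

"`T_{i₁ ↦ j₁, …, i_k ↦ j_k} = ⋂_t T_{i_t ↦ j_t} = {σ ∈ S_n : σ(i_t) = j_t (1 ≤ t ≤ k)}`. If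
`i₁, …, i_k` are distinct and `j₁, …, j_k` are distinct, then `T_{i₁ ↦ j₁, …, i_k ↦ j_k}` is a coset
of the stabilizer of `k` points; we will refer to it as a `k`-coset." (p. 3)
"The Fourier transform of a real-valued function `f : G → ℝ` is a matrix-valued function on
irreducible representations; its value at the irreducible representation `ρ` is the matrix
`f̂(ρ) = (1/|G|) ∑_{s ∈ G} f(s) ρ(s)`." (§2.2, p. 6)
"Let `V_k` be the linear subspace of real-valued functions on `S_n` whose Fourier transform is
supported on irreducible representations corresponding to partitions `μ` of `n` such that
`μ ≥ (n-k,1^k)`, where `≥` denotes the lexicographic order." (§1.2, p. 5; = Definition 12, p. 13)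
"**Theorem 7.** `V_k` is spanned by the characteristic functions of the `k`-cosets of `S_n`."
(§1.2, p. 5; proved in §3.2.3, pp. 13–14, where the proof notes "`V_k` is a 'two-sided ideal' of
the group algebra" and "if `ρ < (n-k,1^k)`, then `ρ` has at least `k+1` cells outside the first
row", i.e. `μ ≥ (n-k,1^k)` lexicographically iff `μ₁ ≥ n - k`.)

## Lean rendering

* `kCoset a b` — the `k`-coset `T_{a ↦ b} = {σ | ∀ i, σ (a i) = b i}` for injective `a b : Fin k ↪ Fin n`.
* `kCosetSpan n k` — the `ℂ`-span, inside `Equiv.Perm (Fin n) → ℂ`, of the indicator functions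
  of the `k`-cosets (complex coefficients: the printed real statement and this one imply each
  other, the indicators being real).
* `fourierSpecht f μ = ∑_σ f σ • ρ_μ(σ)` — the Fourier transform at the irreducible
  representation `[μ]`, modelled by the tree's Specht representation `spechtRep ℂ μ` on
  `S^μ = ℂ[𝔖ₙ] c_μ` (`SymmetricGroupReps.lean`; vanishing of `f̂(ρ)` is invariant under
  equivalence of representations, and the printed factor `1/|G|` does not affect it).
* `efpV n k` — `V_k`: the functions with `f̂([μ]) = 0` for every `μ ⊢ n` with `μ₁ < n - k`
  (largest part `μ.parts.sup`, as in the route file).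
* `EllisFriedgutPilpel2011_thm7` — Theorem 7 verbatim, for `k ≤ n` (the range in which
  `k`-cosets exist; the paper works with `n` large relative to `k`, but the proof of Thm. 7 —
  branching rule one way, Young's rule for `M^{(n-k,1^k)}` the other — is uniform in `k ≤ n`).
  A named fact, not proved here.

What is NOT here: Theorems 5, 6, 8 (the extremal `k`-intersecting families), Young's rule and the
branching rule themselves, and Schensted's count `dim V_k = ∑_{μ₁ ≥ n-k} (f^μ)² = #{π : lis(π) ≥ n-k}`.

## References

* [EllisFriedgutPilpel2011] D. Ellis, E. Friedgut, H. Pilpel, *Intersecting families of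
  permutations*, J. Amer. Math. Soc. 24 (2011), 649–682, doi:10.1090/s0894-0347-2011-00690-5,
  arXiv:1011.3342 — §1.2 Thm. 7, §2.2, §3.2.3 Def. 12.
* [JamesLNM682] G. D. James, *The Representation Theory of the Symmetric Groups*, LNM 682 —
  Young's rule (§14) and the branching theorem (§9), the two inputs of the printed proof.
-/

noncomputable section

open scoped BigOperators

namespace Literature.RepresentationTheory.FiniteGroups

open Literature.NumberTheory.DiophantineGeometry (spechtIdeal spechtRep)

variable {n k : ℕ}

/-- The **`k`-coset** `T_{a ↦ b} = {σ ∈ 𝔖ₙ | σ (a i) = b i for all i}` of two injective `k`-tuples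
`a, b` (Ellis–Friedgut–Pilpel 2011, p. 3: "a coset of the stabilizer of `k` points").
[cite: EllisFriedgutPilpel2011, §1 (k-cosets)] -/
def kCoset (a b : Fin k ↪ Fin n) : Set (Equiv.Perm (Fin n)) :=
  {σ | ∀ i, σ (a i) = b i}

/-- Membership in a `k`-coset, unfolded. [folklore] -/
theorem mem_kCoset_iff (a b : Fin k ↪ Fin n) (σ : Equiv.Perm (Fin n)) :
    σ ∈ kCoset a b ↔ ∀ i, σ (a i) = b i :=
  Iff.rfl

/-- The **span of the `k`-cosets**: the `ℂ`-linear span, inside the functions `𝔖ₙ → ℂ`, of the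
characteristic functions `1_{T_{a ↦ b}}` of all `k`-cosets (Ellis–Friedgut–Pilpel 2011, Thm. 7:
"spanned by the characteristic functions of the `k`-cosets"). [cite: EllisFriedgutPilpel2011, Thm. 7] -/
def kCosetSpan (n k : ℕ) : Submodule ℂ (Equiv.Perm (Fin n) → ℂ) :=
  Submodule.span ℂ {f | ∃ a b : Fin k ↪ Fin n, f = (kCoset a b).indicator 1}

/-- The **Fourier transform at `[μ]`**: `f̂([μ]) = ∑_σ f(σ) ρ_μ(σ) ∈ End(S^μ)`, with `[μ]` modelled
by the Specht representation `spechtRep ℂ μ` (Ellis–Friedgut–Pilpel 2011, §2.2,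
`f̂(ρ) = (1/|G|) ∑_s f(s) ρ(s)`; the positive factor `1/|G|` is dropped — only the vanishing of
`f̂` is used below). [cite: EllisFriedgutPilpel2011, §2.2] -/
def fourierSpecht (f : Equiv.Perm (Fin n) → ℂ) (μ : Nat.Partition n) :
    Module.End ℂ (spechtIdeal ℂ μ) :=
  ∑ σ, f σ • spechtRep ℂ μ σ

/-- `f ↦ f̂([μ])` is linear. [folklore] -/
theorem fourierSpecht_add (f g : Equiv.Perm (Fin n) → ℂ) (μ : Nat.Partition n) :
    fourierSpecht (f + g) μ = fourierSpecht f μ + fourierSpecht g μ := by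
  simp [fourierSpecht, add_smul, Finset.sum_add_distrib]

/-- `f ↦ f̂([μ])` is linear. [folklore] -/
theorem fourierSpecht_smul (c : ℂ) (f : Equiv.Perm (Fin n) → ℂ) (μ : Nat.Partition n) :
    fourierSpecht (c • f) μ = c • fourierSpecht f μ := by
  simp [fourierSpecht, Finset.smul_sum, smul_smul]

/-- **`V_k`** (Ellis–Friedgut–Pilpel 2011, §1.2 / Def. 12): the functions on `𝔖ₙ` whose Fourier
transform is supported on the irreducible representations `[μ]` with `μ ≥ (n-k,1^k)` in the
lexicographic order, i.e. (proof of Thm. 7, p. 14) with `μ₁ ≥ n - k`: `f̂([μ]) = 0` whenever the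
largest part `μ₁ = μ.parts.sup` is `< n - k`. [cite: EllisFriedgutPilpel2011, Def. 12] -/
def efpV (n k : ℕ) : Submodule ℂ (Equiv.Perm (Fin n) → ℂ) where
  carrier := {f | ∀ μ : Nat.Partition n, μ.parts.sup < n - k → fourierSpecht f μ = 0}
  add_mem' {f g} hf hg := fun μ hμ => by
    simp only [Set.mem_setOf_eq] at hf hg
    rw [fourierSpecht_add, hf μ hμ, hg μ hμ, add_zero]
  zero_mem' μ _ := by simp [fourierSpecht]
  smul_mem' c f hf := fun μ hμ => by
    simp only [Set.mem_setOf_eq] at hf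
    rw [fourierSpecht_smul, hf μ hμ, smul_zero]

/-- Membership in `V_k`, unfolded. [folklore] -/
theorem mem_efpV_iff (f : Equiv.Perm (Fin n) → ℂ) :
    f ∈ efpV n k ↔ ∀ μ : Nat.Partition n, μ.parts.sup < n - k → fourierSpecht f μ = 0 :=
  Iff.rfl

/-- **Ellis–Friedgut–Pilpel 2011, Theorem 7** ("`V_k` is spanned by the characteristic functions
of the `k`-cosets of `S_n`"): for `k ≤ n`, the functions on `𝔖ₙ` whose Fourier transform
vanishes at every `[μ]` with `μ₁ < n - k` are exactly the linear combinations of indicator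
functions of `k`-cosets `T_{a ↦ b}`. Printed proof: `⊇` by double-translation invariance of `V_k`
and the branching rule for `T_{1↦1,…,k↦k} ≅ S_{n-k}`; `⊆` by Fourier inversion and Young's rule for
the permutation module `M^{(n-k,1^k)}`. Grounds
`Summit.MatrixMultiplication.MatrixMultiplication.Theses.LevelGradedCohnUmans.TokenBudget` (the
irreducible characters in the `k`-token space are the `χ^μ` with `μ₁ ≥ n - k`) and `.TokenWall`
(`dim V_k = ∑_{μ₁ ≥ n-k} (f^μ)²`). A named fact, not proved here.
[cite: EllisFriedgutPilpel2011, Thm. 7] -/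
def EllisFriedgutPilpel2011_thm7 : Prop :=
  ∀ (n k : ℕ), k ≤ n → efpV n k = kCosetSpan n k

end Literature.RepresentationTheory.FiniteGroups

end
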